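import Mathlib
import Literature.AlgebraicGeometry.Resolution.CohenMacaulayUnmixed

/-!
# Hartshorne's connectedness theorem (`depth A ≥ 2` ⟹ punctured spectrum connected)

Route `SkinnerWilesDefectOne`, crux `ReducibleOrdinaryProModular` (stmt-Langlands-12919), line
`fine-selmer-codimension-two`, registered stub (R) `stub_raynaudConnectedness` (lead skeleton v4,
`Cruxes/ReducibleOrdinaryProModular/Lines/fine_selmer_codimension_two.lean`): for a complete local
Cohen–Macaulay `A` and `R ≅ A ⧸ I` with `n + 1 + μ(I) ≤ dim A`, `Spec R` is connected in dimension `n`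
in the CROSSING FORM — for every two-colouring of the minimal primes of `R` using both colours, two
minimal primes `C₁, C₂` of different colours have `n ≤ dim R/(C₁ + C₂)`.  Its intended proof is
Grothendieck's connectedness theorem [SGA2, XIII 2.1] = [Brodmann–Sharp 19.2.12]
`c(A/𝔞) ≥ min(c(A), sdim A − 1) − ara(𝔞)`, whose hypothesis `c(A) ≥ dim A − 1` for Cohen–Macaulay `A`
is Hartshorne's theorem "a Cohen–Macaulay local ring is connected in codimension one" (sequel file
`…CohenMacaulayConnectedness.lean`).  THIS file proves, sorry-free and WITHOUT local cohomology, the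
regular-sequence core of both [Hartshorne 1962, Prop. 2.1; Eisenbud, *Commutative Algebra*, Thm. 18.12],
for a LOCAL ring `A`:

* `Theorems.eq_bot_or_eq_bot_of_isRegular_pair` — HARTSHORNE'S TRICK: if `𝔞 𝔟 = 0` and `𝔞 + 𝔟`
  contains an `A`-regular sequence `x, y`, then `𝔞 = 0` or `𝔟 = 0`;
* `Theorems.exists_colouring_ideals`, `Theorems.mul_le_nilradical_of_colouring`,
  `Theorems.exists_pow_mul_pow_eq_bot` — the colour-class ideals `𝔞_S`, `𝔟_S` of a two-colouring `S`
  of the (finitely many) minimal primes, `(𝔞_S 𝔟_S)^N = 0`;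
* `Theorems.false_of_isRegular_pair_of_colouring` — `𝔞_S^N + 𝔟_S^N` never contains an `A`-regular
  sequence of length two when both colours are used;
* `Theorems.hartshorne_connectedness` — **Hartshorne's connectedness theorem**: if `𝔪` contains an
  `A`-regular sequence `x, y` (`depth A ≥ 2`), then for every two-colouring of the minimal primes
  using both colours two minimal primes of different colours have `1 ≤ dim A/(C₁ + C₂)`, i.e. the
  punctured spectrum `Spec A ∖ {𝔪}` is connected.

Tree input (PROVED there): `Literature.AlgebraicGeometry.Resolution.isRegular_cons_pow` (powers in
a regular sequence, Matsumura 16.1).  Mathlib: `RingTheory.Sequence.IsRegular`,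
`IsLocalRing.isRegular_of_perm`, `IsNoetherianRing.isNilpotent_nilradical`,
`minimalPrimes.finite_of_isNoetherianRing`, `Ideal.IsPrime.inf_le'`.  Mathlib and the tree have no
Hartshorne / connectedness-in-codimension-one statement (searched: "Hartshorne", "punctured",
"connectedness", `ringKrullDim_quotient`, `minimalPrimes` + `IsRegular`).

References: R. Hartshorne, *Complete intersections and connectedness*, Amer. J. Math. 84 (1962)
497–508, Prop. 2.1 [Hartshorne1962]; D. Eisenbud, *Commutative Algebra with a View Toward Algebraic
Geometry*, GTM 150, Thm. 18.12 [Eisenbud1995]; A. Grothendieck, SGA 2, Exp. III Cor. 3.9 and Exp. XIII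
Thm. 2.1 [Grothendieck1968SGA2]; C. Skinner, A. Wiles, Publ. Math. IHÉS 89 (1999), App. A
[SkinnerWiles1999].
-/

set_option linter.dupNamespace false -- project-wide option (lakefile weak.linter.dupNamespace); `Summit.Langlands.Langlands` is the mandated namespace
set_option autoImplicit false

namespace Summit.Langlands.Langlands.Theorems

open IsLocalRing RingTheory.Sequence
open scoped Pointwise

universe u

variable {A : Type u} [CommRing A]

/-! ## 1. Hartshorne's trick -/

/-- **Hartshorne's trick** [Hartshorne 1962, proof of Prop. 2.1; Eisenbud, proof of Thm. 18.12].
In a local ring, if `𝔞 · 𝔟 = 0` and `𝔞 + 𝔟` contains an `A`-regular sequence `x, y`, then `𝔞 = 0` or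
`𝔟 = 0`.  (Write `x = a₁ + b₁`, `y = a₂ + b₂`; then `y a₁ = a₁ a₂ = x a₂`, so `a₁ = x c` as `y` is
regular modulo `x`, and `b₁ = x (1 - c)`; `c` or `1 - c` is a unit, so `x ∈ 𝔞` or `x ∈ 𝔟`, and the
non-zero-divisor `x` kills the other ideal.) [cite: Hartshorne1962, Prop. 2.1] -/
theorem eq_bot_or_eq_bot_of_isRegular_pair [IsLocalRing A] {𝔞 𝔟 : Ideal A} (h0 : 𝔞 * 𝔟 = ⊥)
    {x y : A} (hreg : IsRegular A [x, y]) (hx : x ∈ 𝔞 ⊔ 𝔟) (hy : y ∈ 𝔞 ⊔ 𝔟) :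
    𝔞 = ⊥ ∨ 𝔟 = ⊥ := by
  obtain ⟨a₁, ha₁, b₁, hb₁, rfl⟩ := Submodule.mem_sup.mp hx
  obtain ⟨a₂, ha₂, b₂, hb₂, rfl⟩ := Submodule.mem_sup.mp hy
  obtain ⟨hx1, hrest⟩ := (isRegular_cons_iff A (a₁ + b₁) [a₂ + b₂]).mp hreg
  have hy1 : IsSMulRegular (QuotSMulTop (a₁ + b₁) A) (a₂ + b₂) :=
    ((isRegular_cons_iff (QuotSMulTop (a₁ + b₁) A) (a₂ + b₂) []).mp hrest).1
  -- products across the two ideals vanish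
  have hab : ∀ a ∈ 𝔞, ∀ b ∈ 𝔟, a * b = 0 := fun a ha b hb =>
    (Submodule.eq_bot_iff _).mp h0 _ (Ideal.mul_mem_mul ha hb)
  -- `y a₁ = x a₂`
  have key : (a₂ + b₂) * a₁ = (a₁ + b₁) * a₂ := by
    have e1 : b₂ * a₁ = 0 := by rw [mul_comm]; exact hab a₁ ha₁ b₂ hb₂
    have e2 : b₁ * a₂ = 0 := by rw [mul_comm]; exact hab a₂ ha₂ b₁ hb₁
    rw [add_mul, add_mul, e1, e2, add_zero, add_zero, mul_comm]
  -- hence `a₁ ∈ (x)`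
  have ha₁x : a₁ ∈ (a₁ + b₁) • (⊤ : Submodule A A) := by
    have h1 : (a₂ + b₂) • (Submodule.Quotient.mk a₁ : QuotSMulTop (a₁ + b₁) A) = 0 := by
      rw [← Submodule.Quotient.mk_smul, Submodule.Quotient.mk_eq_zero, smul_eq_mul, key]
      exact Submodule.smul_mem_pointwise_smul _ _ _ Submodule.mem_top
    have h2 : (Submodule.Quotient.mk a₁ : QuotSMulTop (a₁ + b₁) A) = 0 :=
      hy1 (h1.trans (smul_zero _).symm)
    exact (Submodule.Quotient.mk_eq_zero _).mp h2
  obtain ⟨c, -, hc⟩ := (Submodule.mem_smul_pointwise_iff_exists _ _ _).mp ha₁x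
  rw [smul_eq_mul] at hc
  -- `b₁ = x (1 - c)`
  have hb₁x : (a₁ + b₁) * (1 - c) = b₁ := by rw [mul_sub, mul_one, hc]; ring
  -- the non-zero-divisor `x` kills whichever ideal does not contain it
  have kill : ∀ {𝔠 𝔡 : Ideal A}, (∀ a ∈ 𝔠, ∀ b ∈ 𝔡, a * b = 0) → a₁ + b₁ ∈ 𝔠 → 𝔡 = ⊥ := by
    intro 𝔠 𝔡 h𝔠𝔡 hmem
    refine (Submodule.eq_bot_iff _).mpr fun b hb => ?_
    have h3 : (a₁ + b₁) • b = (a₁ + b₁) • (0 : A) := by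
      rw [smul_eq_mul, smul_zero, h𝔠𝔡 _ hmem b hb]
    exact hx1 h3
  rcases IsLocalRing.isUnit_or_isUnit_one_sub_self c with hu | hu
  · -- `x = a₁ c⁻¹ ∈ 𝔞`, so `𝔟 = 0`
    obtain ⟨u, rfl⟩ := hu
    have hxa : a₁ + b₁ ∈ 𝔞 := by
      have : a₁ + b₁ = a₁ * ↑u⁻¹ := (Units.eq_mul_inv_iff_mul_eq (c := u)).mpr hc
      rw [this]
      exact 𝔞.mul_mem_right _ ha₁
    exact Or.inr (kill hab hxa)
  · -- `x = b₁ (1 - c)⁻¹ ∈ 𝔟`, so `𝔞 = 0`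
    obtain ⟨u, hu⟩ := hu
    have hxb : a₁ + b₁ ∈ 𝔟 := by
      have : a₁ + b₁ = b₁ * ↑u⁻¹ := (Units.eq_mul_inv_iff_mul_eq (c := u)).mpr (by rw [hu]; exact hb₁x)
      rw [this]
      exact 𝔟.mul_mem_right _ hb₁
    exact Or.inl (kill (fun a ha b hb => by rw [mul_comm]; exact hab b hb a ha) hxb)

/-! ## 2. Two-colourings of the minimal primes -/

/-- If `𝔞` lies below every minimal prime of one colour and `𝔟` below every minimal prime of the
other colour, then `𝔞 𝔟` is nil (every prime contains a minimal prime). [folklore] -/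
theorem mul_le_nilradical_of_colouring (S : Set (PrimeSpectrum A)) {𝔞 𝔟 : Ideal A}
    (h𝔞 : ∀ C : PrimeSpectrum A, C ∈ S → C.asIdeal ∈ minimalPrimes A → 𝔞 ≤ C.asIdeal)
    (h𝔟 : ∀ C : PrimeSpectrum A, C ∉ S → C.asIdeal ∈ minimalPrimes A → 𝔟 ≤ C.asIdeal) :
    𝔞 * 𝔟 ≤ nilradical A := by
  rw [nilradical_eq_sInf, le_sInf_iff]
  rintro P (hP : P.IsPrime)
  obtain ⟨p, hp, hpP⟩ := Ideal.exists_minimalPrimes_le (show (⊥ : Ideal A) ≤ P from bot_le)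
  by_cases hS : (⟨p, hp.1.1⟩ : PrimeSpectrum A) ∈ S
  · exact (Ideal.mul_le_right.trans (h𝔞 _ hS hp)).trans hpP
  · exact (Ideal.mul_le_left.trans (h𝔟 _ hS hp)).trans hpP

/-- A nil ideal of a Noetherian ring has a vanishing power; for a product `𝔞 𝔟` this reads
`𝔞^N 𝔟^N = 0` with `N ≥ 1`. [folklore] -/
theorem exists_pow_mul_pow_eq_bot [IsNoetherianRing A] {𝔞 𝔟 : Ideal A} (h : 𝔞 * 𝔟 ≤ nilradical A) :
    ∃ N : ℕ, 0 < N ∧ 𝔞 ^ N * 𝔟 ^ N = ⊥ := by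
  obtain ⟨N, hN⟩ := IsNoetherianRing.isNilpotent_nilradical A
  refine ⟨N + 1, N.succ_pos, ?_⟩
  rw [← mul_pow, eq_bot_iff]
  calc (𝔞 * 𝔟) ^ (N + 1) ≤ nilradical A ^ (N + 1) := Ideal.pow_right_mono h _
    _ ≤ nilradical A ^ N := Ideal.pow_le_pow_right N.le_succ
    _ = ⊥ := hN

/-- Two minimal primes, one below the other, are equal. [folklore] -/
theorem PrimeSpectrum.eq_of_mem_minimalPrimes_of_le {C₁ C₂ : PrimeSpectrum A}
    (h₂ : C₂.asIdeal ∈ minimalPrimes A) (hle : C₁.asIdeal ≤ C₂.asIdeal) : C₁ = C₂ :=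
  PrimeSpectrum.ext (le_antisymm hle (h₂.2 ⟨C₁.isPrime, bot_le⟩ hle))

/-- **No regular pair across a two-colouring.**  Let the minimal primes of the Noetherian local ring
`A` be two-coloured (`S` and its complement) with both colours used, let `𝔞` lie below exactly the
minimal primes in `S` and `𝔟` below exactly those outside `S` (in the sense of the four hypotheses:
below each, and any prime above `𝔞` resp. `𝔟` lies above one of them — e.g. the intersections of the
colour classes), and let `𝔞^N 𝔟^N = 0`.  Then `𝔞^N + 𝔟^N` contains no `A`-regular sequence of length
two.  (Hartshorne's trick gives `𝔞^N = 0` or `𝔟^N = 0`; if `𝔞^N = 0` then `𝔞` lies below a minimal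
prime `C₂ ∉ S`, hence some minimal `C₁ ∈ S` lies below `C₂`, so `C₁ = C₂` — absurd.)
[cite: Hartshorne1962, Prop. 2.1] -/
theorem false_of_isRegular_pair_of_colouring [IsLocalRing A] (S : Set (PrimeSpectrum A))
    (h₁ : ∃ C ∈ S, C.asIdeal ∈ minimalPrimes A) (h₂ : ∃ C ∉ S, C.asIdeal ∈ minimalPrimes A)
    {𝔞 𝔟 : Ideal A}
    (h𝔞' : ∀ P : Ideal A, P.IsPrime → 𝔞 ≤ P →
      ∃ C : PrimeSpectrum A, C ∈ S ∧ C.asIdeal ∈ minimalPrimes A ∧ C.asIdeal ≤ P)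
    (h𝔟' : ∀ P : Ideal A, P.IsPrime → 𝔟 ≤ P →
      ∃ C : PrimeSpectrum A, C ∉ S ∧ C.asIdeal ∈ minimalPrimes A ∧ C.asIdeal ≤ P)
    {N : ℕ} (hN : 0 < N) (h0 : 𝔞 ^ N * 𝔟 ^ N = ⊥)
    {x y : A} (hreg : IsRegular A [x, y]) (hx : x ∈ 𝔞 ^ N ⊔ 𝔟 ^ N) (hy : y ∈ 𝔞 ^ N ⊔ 𝔟 ^ N) :
    False := by
  rcases eq_bot_or_eq_bot_of_isRegular_pair h0 hreg hx hy with h | h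
  · obtain ⟨C₂, hC₂S, hC₂⟩ := h₂
    have hle : 𝔞 ≤ C₂.asIdeal :=
      (Ideal.IsPrime.pow_le_iff (P := C₂.asIdeal) hN.ne').mp (h ▸ bot_le)
    obtain ⟨C₁, hC₁S, -, hC₁le⟩ := h𝔞' C₂.asIdeal C₂.isPrime hle
    exact hC₂S (PrimeSpectrum.eq_of_mem_minimalPrimes_of_le hC₂ hC₁le ▸ hC₁S)
  · obtain ⟨C₁, hC₁S, hC₁⟩ := h₁
    have hle : 𝔟 ≤ C₁.asIdeal :=
      (Ideal.IsPrime.pow_le_iff (P := C₁.asIdeal) hN.ne').mp (h ▸ bot_le)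
    obtain ⟨C₂, hC₂S, -, hC₂le⟩ := h𝔟' C₁.asIdeal C₁.isPrime hle
    exact hC₂S (PrimeSpectrum.eq_of_mem_minimalPrimes_of_le hC₁ hC₂le ▸ hC₁S)

/-- **The colour-class ideals exist** (Noetherian: finitely many minimal primes): there are ideals
`𝔞`, `𝔟` lying below exactly the minimal primes in `S`, resp. outside `S` — the intersections of the
two colour classes. [folklore] -/
theorem exists_colouring_ideals [IsNoetherianRing A] (S : Set (PrimeSpectrum A)) :
    ∃ 𝔞 𝔟 : Ideal A,
      (∀ C : PrimeSpectrum A, C ∈ S → C.asIdeal ∈ minimalPrimes A → 𝔞 ≤ C.asIdeal) ∧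
      (∀ P : Ideal A, P.IsPrime → 𝔞 ≤ P →
        ∃ C : PrimeSpectrum A, C ∈ S ∧ C.asIdeal ∈ minimalPrimes A ∧ C.asIdeal ≤ P) ∧
      (∀ C : PrimeSpectrum A, C ∉ S → C.asIdeal ∈ minimalPrimes A → 𝔟 ≤ C.asIdeal) ∧
      (∀ P : Ideal A, P.IsPrime → 𝔟 ≤ P →
        ∃ C : PrimeSpectrum A, C ∉ S ∧ C.asIdeal ∈ minimalPrimes A ∧ C.asIdeal ≤ P) := by
  classical
  have hfin : {C : PrimeSpectrum A | C.asIdeal ∈ minimalPrimes A}.Finite :=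
    (minimalPrimes.finite_of_isNoetherianRing (R := A)).preimage
      (fun _ _ _ _ h => PrimeSpectrum.ext h)
  set T₁ : Finset (PrimeSpectrum A) := (hfin.inter_of_left S).toFinset with hT₁
  set T₂ : Finset (PrimeSpectrum A) := (hfin.inter_of_left Sᶜ).toFinset with hT₂
  refine ⟨T₁.inf PrimeSpectrum.asIdeal, T₂.inf PrimeSpectrum.asIdeal, ?_, ?_, ?_, ?_⟩
  · intro C hCS hC
    exact Finset.inf_le (by rw [hT₁, Set.Finite.mem_toFinset]; exact ⟨hC, hCS⟩)
  · intro P hP hle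
    obtain ⟨C, hC, hCle⟩ := (Ideal.IsPrime.inf_le' hP).mp hle
    rw [hT₁, Set.Finite.mem_toFinset] at hC
    exact ⟨C, hC.2, hC.1, hCle⟩
  · intro C hCS hC
    exact Finset.inf_le (by rw [hT₂, Set.Finite.mem_toFinset]; exact ⟨hC, hCS⟩)
  · intro P hP hle
    obtain ⟨C, hC, hCle⟩ := (Ideal.IsPrime.inf_le' hP).mp hle
    rw [hT₂, Set.Finite.mem_toFinset] at hC
    exact ⟨C, hC.2, hC.1, hCle⟩

/-! ## 3. Hartshorne's connectedness theorem (`depth A ≥ 2` ⟹ punctured spectrum connected) -/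

/-- In a local ring, if `A ⧸ I` has Krull dimension `< 1` then every prime above `I` is the maximal
ideal (a prime `P ⊇ I` with `P ≠ 𝔪` gives the chain `P < 𝔪` in `V(I)`). [folklore] -/
theorem eq_maximalIdeal_of_ringKrullDim_quotient_lt_one [IsLocalRing A] {I P : Ideal A}
    (hP : P.IsPrime) (hIP : I ≤ P) (hdim : ringKrullDim (A ⧸ I) < 1) : P = maximalIdeal A := by
  by_contra hne
  have hlt : P < maximalIdeal A := lt_of_le_of_ne (IsLocalRing.le_maximalIdeal hP.ne_top) hne
  have h1 : (1 : WithBot ℕ∞) ≤ ringKrullDim (A ⧸ I) := by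
    rw [ringKrullDim_quotient, Order.one_le_krullDim_iff]
    refine ⟨⟨⟨P, hP⟩, fun r hr => hIP hr⟩, ⟨⟨maximalIdeal A, inferInstance⟩, fun r hr => hlt.le (hIP hr)⟩, ?_⟩
    exact Subtype.mk_lt_mk.mpr ((PrimeSpectrum.asIdeal_lt_asIdeal _ _).mp hlt)
  exact (not_le.mpr hdim) h1

/-- **Hartshorne's connectedness theorem** [Hartshorne 1962, Prop. 2.1; Eisenbud, *Commutative
Algebra*, Thm. 18.12]: a Noetherian local ring of depth `≥ 2` — here: admitting an `A`-regular sequence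
`x, y` in `𝔪` — has connected punctured spectrum.  Crossing form: for every two-colouring of the
minimal primes of `A` using both colours there are minimal primes `C₁, C₂` of different colours with
`1 ≤ dim A/(C₁ + C₂)`, i.e. `V(C₁) ∩ V(C₂) ≠ {𝔪}`.  Proof: otherwise every prime above the
colour-class ideal `𝔞^N + 𝔟^N` is `𝔪`, so suitable powers of `x, y` — again an `A`-regular sequence —
lie in it, contradicting `false_of_isRegular_pair_of_colouring`. [cite: Hartshorne1962, Prop. 2.1] -/
theorem hartshorne_connectedness [IsNoetherianRing A] [IsLocalRing A] {x y : A}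
    (hreg : IsRegular A [x, y]) (hx : x ∈ maximalIdeal A) (hy : y ∈ maximalIdeal A)
    (S : Set (PrimeSpectrum A)) (h₁ : ∃ C ∈ S, C.asIdeal ∈ minimalPrimes A)
    (h₂ : ∃ C ∉ S, C.asIdeal ∈ minimalPrimes A) :
    ∃ C₁ ∈ S, ∃ C₂ ∉ S, C₁.asIdeal ∈ minimalPrimes A ∧ C₂.asIdeal ∈ minimalPrimes A ∧
      (1 : WithBot ℕ∞) ≤ ringKrullDim (A ⧸ (C₁.asIdeal ⊔ C₂.asIdeal)) := by
  by_contra H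
  push Not at H
  obtain ⟨𝔞, 𝔟, h𝔞, h𝔞', h𝔟, h𝔟'⟩ := exists_colouring_ideals S
  obtain ⟨N, hN, h0⟩ := exists_pow_mul_pow_eq_bot (mul_le_nilradical_of_colouring S h𝔞 h𝔟)
  set J : Ideal A := 𝔞 ^ N ⊔ 𝔟 ^ N with hJ
  -- every prime above `J` is `𝔪`
  have hJm : ∀ P : Ideal A, P.IsPrime → J ≤ P → P = maximalIdeal A := by
    intro P hP hJP
    have ha : 𝔞 ≤ P := (Ideal.IsPrime.pow_le_iff (P := P) hN.ne').mp (le_sup_left.trans hJP)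
    have hb : 𝔟 ≤ P := (Ideal.IsPrime.pow_le_iff (P := P) hN.ne').mp (le_sup_right.trans hJP)
    obtain ⟨C₁, hC₁S, hC₁, hC₁P⟩ := h𝔞' P hP ha
    obtain ⟨C₂, hC₂S, hC₂, hC₂P⟩ := h𝔟' P hP hb
    exact eq_maximalIdeal_of_ringKrullDim_quotient_lt_one hP (sup_le hC₁P hC₂P)
      (H C₁ hC₁S C₂ hC₂S hC₁ hC₂)
  -- hence `𝔪 ≤ √J`: powers of `x` and `y` lie in `J`
  have hrad : maximalIdeal A ≤ J.radical := by
    rw [Ideal.radical_eq_sInf, le_sInf_iff]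
    rintro P ⟨hJP, hP⟩
    exact (hJm P hP hJP).ge
  obtain ⟨k, hk⟩ := hrad hx
  obtain ⟨l, hl⟩ := hrad hy
  have hxJ : x ^ (k + 1) ∈ J := by rw [pow_succ]; exact J.mul_mem_right _ hk
  have hyJ : y ^ (l + 1) ∈ J := by rw [pow_succ]; exact J.mul_mem_right _ hl
  -- `x^(k+1), y^(l+1)` is again an `A`-regular sequence
  have hmem : ∀ r ∈ [x, y], r ∈ maximalIdeal A := by
    intro r hr
    simp only [List.mem_cons, List.not_mem_nil, or_false] at hr
    rcases hr with rfl | rfl <;> assumption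
  have hreg1 : IsRegular A [x ^ (k + 1), y] :=
    Literature.AlgebraicGeometry.Resolution.isRegular_cons_pow hreg hmem k.succ_pos
  have hreg2 : IsRegular A [y, x ^ (k + 1)] :=
    IsLocalRing.isRegular_of_perm hreg1 (List.Perm.swap y (x ^ (k + 1)) [])
  have hmem2 : ∀ r ∈ [y, x ^ (k + 1)], r ∈ maximalIdeal A := by
    intro r hr
    simp only [List.mem_cons, List.not_mem_nil, or_false] at hr
    rcases hr with rfl | rfl
    · exact hy
    · exact Ideal.pow_mem_of_mem _ hx _ k.succ_pos
  have hreg3 : IsRegular A [y ^ (l + 1), x ^ (k + 1)] :=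
    Literature.AlgebraicGeometry.Resolution.isRegular_cons_pow hreg2 hmem2 l.succ_pos
  have hreg4 : IsRegular A [x ^ (k + 1), y ^ (l + 1)] :=
    IsLocalRing.isRegular_of_perm hreg3 (List.Perm.swap (x ^ (k + 1)) (y ^ (l + 1)) [])
  exact false_of_isRegular_pair_of_colouring S h₁ h₂ h𝔞' h𝔟' hN h0 hreg4 hxJ hyJ

end Summit.Langlands.Langlands.Theorems

/-! ## 4. The registered sub-goal (verbatim signature) -/

namespace Summit.Langlands.Langlands.Cruxes.ReducibleOrdinaryProModular.FineSelmerCodimensionTwo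

/-- **Registered sub-goal `stub_raynaudConnectedness_auxHartshorne` of stub (R)
`stub_raynaudConnectedness`** (line fine-selmer-codimension-two): Hartshorne's connectedness theorem in
crossing form, `Theorems.hartshorne_connectedness` at universe `0`. [cite: Hartshorne1962, Prop. 2.1] -/
theorem stub_raynaudConnectedness_auxHartshorne :
    ∀ (A : Type) [CommRing A] [IsNoetherianRing A] [IsLocalRing A] (x y : A),
      RingTheory.Sequence.IsRegular A [x, y] → x ∈ IsLocalRing.maximalIdeal A →
      y ∈ IsLocalRing.maximalIdeal A →
      ∀ S : Set (PrimeSpectrum A), (∃ C ∈ S, C.asIdeal ∈ minimalPrimes A) →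
        (∃ C ∉ S, C.asIdeal ∈ minimalPrimes A) →
          ∃ C₁ ∈ S, ∃ C₂ ∉ S, C₁.asIdeal ∈ minimalPrimes A ∧ C₂.asIdeal ∈ minimalPrimes A ∧
            (1 : WithBot ℕ∞) ≤ ringKrullDim (A ⧸ (C₁.asIdeal ⊔ C₂.asIdeal)) :=
  fun _ _ _ _ _ _ hreg hx hy S h₁ h₂ =>
    Summit.Langlands.Langlands.Theorems.hartshorne_connectedness hreg hx hy S h₁ h₂

end Summit.Langlands.Langlands.Cruxes.ReducibleOrdinaryProModular.FineSelmerCodimensionTwo
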